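/-
Copyright (c) 2026 the pub-hodgecm-mathlib formalisation cell (harness21).  Prover seat hodgecm-mathlib-LH7-p04 (g12), 2026-09-03.
Road M6 → F3 «TOT-Λ BY OVER-ORDERS» (LEAD F0P3a-plan (g16) T14-66; sigsheet SIG-F3-5 v1 6925585c, F3-5 pen by (α)-lineage), brick F3-5b-I «THE PER-STRATUM VERDICTS».
-/
import Literature.NumberTheory.Automorphic.SelfDualMultiplierOrderGorenstein   -- ★ F3-2b FILE 3 (LH7-p04 (g11)) p853019: (B3a) `map_le_of_map_le_star`, (B3b) `exists_setOf_inr_mem_eq_image`; brings ★ FILE 2 ((A8) `setOf_map_le_span_image_eq_of_eq_span_range`), ★ F3-2a (count, `…_eq_empty`, `exists_units_of_mem_over`)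
import Literature.NumberTheory.Automorphic.GluedOverOrderUnitaryGenerator       -- ★ F3-3 (LH4-p01 (g9)) p852997: (UG) `exists_unitary_generator_glued`; brings ★ (L3′) `relIndex_units_comap_norm_eq_eisenstein`, `map_k₀_mem_maximalIdeal`
import Literature.NumberTheory.Automorphic.GluedOverOrderLevelFromPrincipal      -- ★ (ii) (LH10-p01 (g10)) p853044: `level_of_slice_principal`, `level_map_iff`, `map_mem_span_pow_iff`; brings ★ F3-1a (`image_prodMap_glued`, `glued_subset_glued_iff`, `glued_eq_glued_iff`, `exists_map_rep_of_sub_mem_span`)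
import Literature.NumberTheory.Automorphic.OverOrderIntegralReading              -- ★ (c4) (LH10-p01 (g10)) p853025: `relIndex_units_map_prodMap_eq`, `prodMap_integer_subtype_injective`
import HarnessLib

/-!
# The per-stratum verdicts of the over-order partition: hermitian ∧ monogenic level (non-empty strata), the count `(q+1)q^{N″+b−1}` (right parity), emptiness (wrong parity)

Topic `NumberTheory/Automorphic`; namespace `Literature.NumberTheory.Automorphic`.  THEOREMS ONLY (no definition, no instance, no notation, no named fact, no `sorry`).
Cell `pub/hodgecm-mathlib` (D-0151), crux H413 = `stmt-HodgeConjecture-24833`; road M6 → F3 «TOT-Λ by over-orders», brick **F3-5b-I**: the three per-stratum BINDERS of ★-to-be F3-5a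
`OverOrderStrataTotal.ncard_setOf_selfDual_stable_eq_lawSum` (`hzero`, `hgood`, `hbad`) discharged at the glue depths `b ≥ 1` (and `hzero` at every `b`), in ★ F3-2b's endoscopic frame
(`E ⊂ K`, `φ : E × K → M₃(E)`, `τ_B`, the adjoint `⋆ = (σ, σ_K)`), read integrally as in ★ (c4) (`jO`, `incl = (coe, coe)`, integral involutions `σO`, `σKO` over `σ`, `σ_K`), with
★ F3-3's Eisenstein letters over the inert dictionary `ιO : 𝒪_F → 𝒪_E` (`θ² = jO(ιO a)θ + jO(ιO k₀)`, `a, k₀ ∈ 𝔪_F`, `σKO θ = θ`, unique coordinates, the unit different `ξ`, Hilbert 90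
at level `b` `hnormEb`, unit norms `hnormE ∕ hnorm₁`, `#𝓀_E = #𝓀_F²`).  The PARITY of a stratum enters through ONE binder `hgate` about the order `𝒪_E[x′]` generated by a DEEP UNITARY
`x′ = (u′, jO p′ + jO q′·θ)` of exponents `(N″, b)` (★ (UG)'s output, token for token): «a self-dual `𝒪_E[x′]`-cyclic lattice exists ⟺ `b ≡ cls (2)`» — the ★ F4 gate read at
`τ′ = φ(incl x′)` through ★ (c8) and the model package (c5-ii) (F3-5b-II∕III).  The boundary `b = 0` (product orders) is ★ (c10) + (c10b).
HONEST LABEL: HC_CM is proved only modulo the 2 remaining named inputs (hLiu418 24832, h413 24833) until rung 0 closes; lattice∕order algebra over a DVR, asserts nothing printed;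
count-neutral (pays no organ; zero label movement until F5 ★ and a desk-priced rider).

THE MATHEMATICS.  (§1, `hzero`) If the stratum `S_O` of `O = incl S`, `↑S = G(N″, b, c′)`, contains a lattice `Λ = Λ(u) = Λ_O(w)`, then `O` is the multiplier ring of `Λ` (★ (A8)),
which is `⋆`-stable because `Λ` is self-dual (★ (B3a)); so `⋆G(N″,b,c′) = G(N″,b,σO c′) ⊆ G(N″,b,c′)` (★ F3-1a (S3)) and `c′` is HERMITIAN, `σO c′ ≡ c′ (π^b)` (★ `glued_subset_glued_iff`);
and for `b ≥ 1` the `K`-slice `{y | (0, y) ∈ O}` is principal over `pr_K O` (★ (B3b)), which read in `𝒪_E × 𝒪_K` (`ν ∈ 𝒪_K` because `(0, ν) ∈ O ⊆ incl(𝒪_E × 𝒪_K)`) is ★ (ii)'s `hprin`,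
whence the MONOGENIC LEVEL `Lvl_E(N″, b, c′)` (★ `level_of_slice_principal`).  (§2) A hermitian `c′` at a monogenic level has a representative `ιO y`, `y ∈ 𝒪_F`, at the same level
(★ F3-1a (S4), ★ (ii) `level_map_iff`), so ★ (UG) gives a deep unitary `x′` with `𝒪_E[x′] = G(N″, b, ιO y) = G(N″, b, c′)`; then (`hgood`) under the right parity `hgate` yields a
self-dual `O`-cyclic lattice, i.e. a good unit (★ F3-2a `exists_units_of_mem_over`), so `#S_O = [C_O : O^×]` (★ F3-2a) `= [C : 𝒪_E[x′]^×]` (★ (c4) §3) `= (q+1)q^{N″+b−1}` (★ (L3′));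
and (`hbad`) under the wrong parity no `Λ_O(w)` is self-dual, so `S_O = ∅` (★ F3-2a `setOf_selfDual_cyclicOver_eq_empty`).

* §1 `exists_integer_slice_eq_image` (the integral reading of (B3b)'s principal slice), **`herm_and_level_of_stratum_nonempty`** (`hzero`).
* §2 `exists_map_rep_and_level_of_level` (hermitian lift at a level), **`exists_subring_ncard_stratum_eq_of_gate`** (`hgood`, `b ≥ 1`), **`stratum_eq_empty_of_gate`** (`hbad`, `b ≥ 1`).

## References
* [Jacobowitz1962] R. Jacobowitz, *Hermitian forms over local fields*, Amer. J. Math. 84 (1962): §4, §7 (unimodular lattices, their orders, lattices of an order as a units-torsor).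
* [Bass1963] H. Bass, *On the ubiquity of Gorenstein rings*, Math. Z. 82 (1963): §7 (lattices over quadratic orders are cyclic over their multiplier rings; principal duals).
* [Neukirch1999] J. Neukirch, *Algebraic Number Theory*, Grundlehren 322 (1999): Ch. I §12 (orders, conductors, fibre products).
* [SerreLocalFields1979] J.-P. Serre, *Local Fields*, GTM 67 (1979): Ch. V §2 Prop. 3 (unit norms, unramified case); Ch. X §1 (Hilbert 90).
* [Rogawski1990] J. D. Rogawski, *Automorphic Representations of Unitary Groups in Three Variables*, Ann. of Math. Stud. 123 (1990): §4.9 Lemma 4.9.3 p. 56, Prop. 4.9.1 (b) p. 55.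
-/

set_option autoImplicit false

noncomputable section

open Matrix Polynomial
open scoped MatrixGroups ValuativeRel Pointwise

namespace Literature.NumberTheory.Automorphic

open Literature.NumberTheory.Automorphic.UnitaryGroup ValuativeRel

variable {F E : Type*} [Field F] [ValuativeRel F] [Field E] [ValuativeRel E] (σ : E →+* E)
  {K : Type*} [Field K] [ValuativeRel K] [Algebra E K] (σK : K →+* K)
  -- ★ F3-2b ∕ F3-2a's endoscopic frame
  (hσσ : ∀ x, σ (σ x) = x) (hσO : ∀ x : 𝒪[E], σ x ∈ 𝒪[E]) (hK2 : Module.finrank E K = 2)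
  (J : GL (Fin 3) E) (hJ : J ∈ glInt 3 E) (hJh : ((J : Matrix (Fin 3) (Fin 3) E).map σ)ᵀ = J)
  (τ : Matrix (Fin 3) (Fin 3) E) {w₀ : Fin 3 → E} (hK : IsUnit (Matrix.of fun i j : Fin 3 => ((τ ^ (j : ℕ)) *ᵥ w₀) i).det)
  (φ : (E × K) →ₐ[E] Matrix (Fin 3) (Fin 3) E) (hφ : Function.Injective φ) (τB : E × K) (hτB : φ τB = τ)
  (hstar : ∀ b : E × K, (J : Matrix (Fin 3) (Fin 3) E) * φ (RingHom.prodMap σ σK b) = ((φ b).map σ)ᵀ * J)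
  -- ★ (c4)'s integral reading
  (hOK : ∀ r : 𝒪[E], algebraMap E K (r : E) ∈ 𝒪[K])
  (jO : 𝒪[E] →+* 𝒪[K]) (hjO : ∀ x : 𝒪[E], ((jO x : 𝒪[K]) : K) = algebraMap E K x)
  (σO : 𝒪[E] →+* 𝒪[E]) (hσO' : ∀ x : 𝒪[E], ((σO x : 𝒪[E]) : E) = σ x)
  (σKO : 𝒪[K] →+* 𝒪[K]) (hσKO : ∀ z : 𝒪[K], ((σKO z : 𝒪[K]) : K) = σK z)
  (hσv : ∀ x, valuation E (σ x) = valuation E x) (hσKv : ∀ z, valuation K (σK z) = valuation K z)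
  -- ★ F3-3 ∕ F3-1a's Eisenstein letters over the inert dictionary, at `O₁ := 𝒪[K]`
  (ιO : 𝒪[F] →+* 𝒪[E]) (θ : 𝒪[K]) {aF k₀F : 𝒪[F]}
  (hσι : ∀ y, σO (ιO y) = ιO y) (hfixO : ∀ x, σO x = x → ∃ y, ιO y = x) (hιinj : Function.Injective ιO) (hιu : ∀ y, IsUnit (ιO y) → IsUnit y)
  (htr : ∃ b₀ : 𝒪[E], b₀ + σO b₀ = 1)
  (hσ₁j : ∀ x, σKO (jO x) = jO (σO x)) (hσ₁θ : σKO θ = θ)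
  (hθ : θ ^ 2 = jO (ιO aF) * θ + jO (ιO k₀F)) (haF : aF ∈ IsLocalRing.maximalIdeal 𝒪[F]) (hk₀ : k₀F ∈ IsLocalRing.maximalIdeal 𝒪[F])
  (hcoord : ∀ z : 𝒪[K], ∃! bc : 𝒪[E] × 𝒪[E], z = jO bc.1 + jO bc.2 * θ)
  (hnormE : ∀ b : 𝒪[E], IsUnit b → σO b = b → ∃ c : 𝒪[E], c * σO c = b) (hnorm₁ : ∀ z : 𝒪[K], IsUnit z → σKO z = z → ∃ w : 𝒪[K], w * σKO w = z)
  {ϖF : F} {ϖ : E} (hϖF : IsUniformizingElement ϖF) (hϖ : IsUniformizingElement ϖ) (hιϖ : ιO ⟨ϖF, hϖF.mem⟩ = ⟨ϖ, hϖ.mem⟩)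
  (hk₁ : valuation E ((ιO k₀F : 𝒪[E]) : E) = valuation E ϖ) (hq : Nat.card 𝓀[E] = Nat.card 𝓀[F] ^ 2)
  {ξ : 𝒪[E]} (hξ : IsUnit (ξ - σO ξ))
  (hnormEb : ∀ b : ℕ, 1 ≤ b → ∀ r : 𝒪[E], σO r = r → r - 1 ∈ Ideal.span ({(⟨ϖ, hϖ.mem⟩ : 𝒪[E]) ^ b} : Set 𝒪[E]) →
    ∃ w : 𝒪[E], w - 1 ∈ Ideal.span ({(⟨ϖ, hϖ.mem⟩ : 𝒪[E]) ^ b} : Set 𝒪[E]) ∧ w * σO w = r)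
  (cls : ℕ)
  -- the PARITY GATE at a deep unitary generator (★ (UG)'s output tokens; F3-5b-II∕III: ★ (c8) + the F4 gates + the model package)
  (hgate : ∀ (N'' b : ℕ) (u' p' q' t' D' : 𝒪[E]), 1 ≤ b →
    ((u', jO p' + jO q' * θ) : 𝒪[E] × 𝒪[K]) * RingHom.prodMap σO σKO (u', jO p' + jO q' * θ) = 1 →
    u' - 1 ∈ IsLocalRing.maximalIdeal 𝒪[E] → p' - 1 ∈ IsLocalRing.maximalIdeal 𝒪[E] → 1 - t' + D' ∈ IsLocalRing.maximalIdeal 𝒪[E] →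
    (jO p' + jO q' * θ) ^ 2 - jO t' * (jO p' + jO q' * θ) + jO D' = 0 →
    valuation E ((q' : 𝒪[E]) : E) = valuation E ϖ ^ N'' →
    valuation E ((u' * u' - t' * u' + D' : 𝒪[E]) : E) = valuation E ϖ ^ b →
    ((∃ w : Fin 3 → E, ∃ g ∈ unitaryGroupOfForm σ (J : Matrix (Fin 3) (Fin 3) E),
        Submodule.span 𝒪[E] ((fun x : E × K => φ x *ᵥ w) ''
          (((Polynomial.eval₂RingHom (RingHom.prod (RingHom.id 𝒪[E]) jO) ((u', jO p' + jO q' * θ) : 𝒪[E] × 𝒪[K])).range.map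
            (RingHom.prodMap (𝒪[E]).subtype (𝒪[K]).subtype) : Subring (E × K)) : Set (E × K))) =
        Submodule.span 𝒪[E] (Set.range ((g : Matrix (Fin 3) (Fin 3) E))ᵀ)) ↔ b % 2 = cls))

/-! ## §1 `hzero`: a non-empty stratum has a hermitian character value at a monogenic level -/

include hjO in
/-- The scalars `algebraMap E (E × K) (𝒪_E)` lie in `incl S` whenever `↑S` is a glued set (the diagonal `(r, jO r)` lies in every `G(N″, b, c′)`). [cite: Neukirch1999, Ch. I §12] -/
theorem algebraMap_mem_map_of_coe_eq_glued (S : Subring (𝒪[E] × 𝒪[K])) {N'' b : ℕ} {c' : 𝒪[E]}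
    (hS : (S : Set (𝒪[E] × 𝒪[K])) = {z : 𝒪[E] × 𝒪[K] | ∃ b₀ c₀ : 𝒪[E], z.2 = jO b₀ + jO c₀ * (jO ((⟨ϖ, hϖ.mem⟩ : 𝒪[E]) ^ N'') * θ) ∧
      z.1 - (b₀ + c₀ * c') ∈ Ideal.span {(⟨ϖ, hϖ.mem⟩ : 𝒪[E]) ^ b}}) (r : 𝒪[E]) :
    algebraMap E (E × K) (r : E) ∈ S.map (RingHom.prodMap (𝒪[E]).subtype (𝒪[K]).subtype) := by
  have h : RingHom.prodMap (𝒪[E]).subtype (𝒪[K]).subtype ((r, jO r) : 𝒪[E] × 𝒪[K]) = algebraMap E (E × K) (r : E) := by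
    rw [Prod.algebraMap_apply, Algebra.algebraMap_self, RingHom.id_apply, ← hjO]; rfl
  rw [← h]
  refine Subring.mem_map.2 ⟨(r, jO r), ?_, rfl⟩
  rw [← SetLike.mem_coe, hS]
  exact ⟨r, 0, by simp, by simp⟩

omit [Algebra E K] in
/-- **THE INTEGRAL READING OF (B3b)'s PRINCIPAL SLICE.**  If `O = incl S` and `{y ∈ K | (0, y) ∈ O} = (pr_K O)·ν`, then `ν ∈ 𝒪_K` and `{s ∈ 𝒪_K | (0, s) ∈ S} = (pr S)·ν` —
★ (ii)'s `hprin` for `↑S`. [cite: Bass1963, §7] [cite: Neukirch1999, Ch. I §12] -/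
theorem exists_integer_slice_eq_image (S : Subring (𝒪[E] × 𝒪[K])) {ν : K}
    (hν : {y : K | ((0 : E), y) ∈ S.map (RingHom.prodMap (𝒪[E]).subtype (𝒪[K]).subtype)} =
      (fun c : E × K => c.2 * ν) '' ((S.map (RingHom.prodMap (𝒪[E]).subtype (𝒪[K]).subtype) : Subring (E × K)) : Set (E × K))) :
    ∃ νO : 𝒪[K], {s : 𝒪[K] | (((0 : 𝒪[E]), s) : 𝒪[E] × 𝒪[K]) ∈ (S : Set (𝒪[E] × 𝒪[K]))} = (fun g : 𝒪[E] × 𝒪[K] => g.2 * νO) '' (S : Set (𝒪[E] × 𝒪[K])) := by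
  set incl : 𝒪[E] × 𝒪[K] →+* E × K := RingHom.prodMap (𝒪[E]).subtype (𝒪[K]).subtype with hincl
  -- `ν ∈ 𝒪_K`: `(0, ν) = (0, 1·ν) ∈ O ⊆ incl (𝒪_E × 𝒪_K)`
  have hν1 : ((0 : E), ν) ∈ S.map incl := by
    have h1 : ν ∈ {y : K | ((0 : E), y) ∈ S.map incl} := by
      rw [hν]; exact ⟨1, (S.map incl).one_mem, by simp⟩
    exact h1
  obtain ⟨z, -, hz0⟩ := Subring.mem_map.1 hν1
  have hνO : ν ∈ 𝒪[K] := by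
    have h2 : ((z.2 : 𝒪[K]) : K) = ν := congrArg Prod.snd hz0
    rw [← h2]; exact z.2.2
  refine ⟨⟨ν, hνO⟩, ?_⟩
  ext s
  simp only [Set.mem_setOf_eq, Set.mem_image, SetLike.mem_coe]
  constructor
  · intro hs
    have h1 : ((s : 𝒪[K]) : K) ∈ {y : K | ((0 : E), y) ∈ S.map incl} :=
      Subring.mem_map.2 ⟨((0 : 𝒪[E]), s), hs, rfl⟩
    rw [hν] at h1
    obtain ⟨c, hc, hcs⟩ := h1
    obtain ⟨g, hg, rfl⟩ := Subring.mem_map.1 hc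
    refine ⟨g, hg, Subtype.ext ?_⟩
    rw [Subring.coe_mul]; exact hcs
  · rintro ⟨g, hg, rfl⟩
    have h1 : (incl g).2 * ν ∈ {y : K | ((0 : E), y) ∈ S.map incl} := by
      rw [hν]; exact ⟨incl g, Subring.mem_map.2 ⟨g, hg, rfl⟩, rfl⟩
    obtain ⟨z', hz', hz'0⟩ := Subring.mem_map.1 h1
    have hzz : z' = ((0 : 𝒪[E]), g.2 * ⟨ν, hνO⟩) :=
      prodMap_integer_subtype_injective (by rw [hz'0]; rfl)
    rw [hzz] at hz'
    exact hz'

include hσσ hσO hK2 hJ hK hφ hτB hstar hjO hσO' hσKO hσ₁j hσ₁θ hθ haF hιu hcoord hσι hιϖ hk₁ in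
/-- **`hzero` — A NON-EMPTY STRATUM HAS A HERMITIAN CHARACTER VALUE AT A MONOGENIC LEVEL.**  `O = incl S` with `↑S = G(N″, b, c′)` (`c′` lawful); if some self-dual `Λ(u)`,
`u ∈ U(σ,J)`, is `O`-cyclic then (i) `σO c′ ≡ c′ (π^b)` — `O` is the multiplier ring of `Λ` (★ (A8)), `⋆`-stable by self-duality (★ (B3a)), and `⋆G(N″,b,c′) = G(N″,b,σO c′)` (★ F3-1a (S3));
(ii) `b = 0` or `Lvl_E(N″, b, c′)` — the `K`-slice of `O` is principal (★ (B3b)), read integrally (§1) it is ★ (ii)'s `hprin`, and ★ `level_of_slice_principal` pins the level.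
[cite: Jacobowitz1962, §4, §7] [cite: Bass1963, §7] [cite: Rogawski1990, §4.9 Lemma 4.9.3 p. 56] -/
theorem herm_and_level_of_stratum_nonempty [IsDiscreteValuationRing 𝒪[E]] {N'' b : ℕ} {c' : 𝒪[E]}
    (hlaw : c' * c' - ((⟨ϖ, hϖ.mem⟩ : 𝒪[E]) ^ N'' * ιO aF * c' + (⟨ϖ, hϖ.mem⟩ : 𝒪[E]) ^ (2 * N'') * ιO k₀F) ∈ Ideal.span {(⟨ϖ, hϖ.mem⟩ : 𝒪[E]) ^ b})
    (S : Subring (𝒪[E] × 𝒪[K]))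
    (hS : (S : Set (𝒪[E] × 𝒪[K])) = {z : 𝒪[E] × 𝒪[K] | ∃ b₀ c₀ : 𝒪[E], z.2 = jO b₀ + jO c₀ * (jO ((⟨ϖ, hϖ.mem⟩ : 𝒪[E]) ^ N'') * θ) ∧
      z.1 - (b₀ + c₀ * c') ∈ Ideal.span {(⟨ϖ, hϖ.mem⟩ : 𝒪[E]) ^ b}})
    (hne : {Λ : Submodule 𝒪[E] (Fin 3 → E) |
        (∃ u ∈ unitaryGroupOfForm σ (J : Matrix (Fin 3) (Fin 3) E), Λ = Submodule.span 𝒪[E] (Set.range ((u : Matrix (Fin 3) (Fin 3) E))ᵀ)) ∧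
          ∃ w : Fin 3 → E, Λ = Submodule.span 𝒪[E] ((fun x : E × K => φ x *ᵥ w) ''
            ((S.map (RingHom.prodMap (𝒪[E]).subtype (𝒪[K]).subtype) : Subring (E × K)) : Set (E × K)))}.Nonempty) :
    σO c' - c' ∈ Ideal.span ({(⟨ϖ, hϖ.mem⟩ : 𝒪[E]) ^ b} : Set 𝒪[E]) ∧
      (b = 0 ∨ (b = 2 * N'' + 1 ∧ c' ∈ Ideal.span ({(⟨ϖ, hϖ.mem⟩ : 𝒪[E]) ^ (N'' + 1)} : Set 𝒪[E])) ∨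
        ∃ M : ℕ, 1 ≤ M ∧ M ≤ N'' ∧ b = 2 * M ∧ c' ∈ Ideal.span ({(⟨ϖ, hϖ.mem⟩ : 𝒪[E]) ^ M} : Set 𝒪[E]) ∧
          c' ∉ Ideal.span ({(⟨ϖ, hϖ.mem⟩ : 𝒪[E]) ^ (M + 1)} : Set 𝒪[E])) := by
  set π : 𝒪[E] := ⟨ϖ, hϖ.mem⟩ with hπdef
  have hπ0 : π ≠ 0 := hϖ.coe_ne_zero
  have hπu : ¬ IsUnit π := hϖ.irreducible_coe.not_isUnit
  have hσσO : ∀ x, σO (σO x) = x := fun x => Subtype.ext (by rw [hσO', hσO', hσσ])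
  have hσϖ : σO π = π := by rw [← hιϖ, hσι]
  set incl : 𝒪[E] × 𝒪[K] →+* E × K := RingHom.prodMap (𝒪[E]).subtype (𝒪[K]).subtype with hincl
  set O : Subring (E × K) := S.map incl with hOdef
  have hO : ∀ r : 𝒪[E], algebraMap E (E × K) (r : E) ∈ O := algebraMap_mem_map_of_coe_eq_glued jO hjO θ hϖ S hS
  obtain ⟨Λ, ⟨u, hu, rfl⟩, w, hw⟩ := hne
  -- (A8): `O` is the multiplier ring of `Λ(u)`
  have hmult : {x : E × K | (Submodule.span 𝒪[E] (Set.range ((u : Matrix (Fin 3) (Fin 3) E))ᵀ)).map ((Matrix.toLin' (φ x)).restrictScalars 𝒪[E]) ≤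
      Submodule.span 𝒪[E] (Set.range ((u : Matrix (Fin 3) (Fin 3) E))ᵀ)} = (O : Set (E × K)) := by
    have h := setOf_map_le_span_image_eq_of_eq_span_range τ hK φ hφ τB hτB O hO w u hw.symm
    rw [← hw] at h
    exact h
  -- (B3a): `⋆S ⊆ S`
  have hstarS : ∀ z ∈ S, RingHom.prodMap σO σKO z ∈ S := by
    intro z hz
    have hzO : incl z ∈ (O : Set (E × K)) := Subring.mem_map.2 ⟨z, hz, rfl⟩
    rw [← hmult] at hzO
    have hx' := map_le_of_map_le_star σ hσO J hJ φ (RingHom.prodMap σ σK) hstar hu (incl z) hzO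
    have hmem : RingHom.prodMap σ σK (incl z) ∈ (O : Set (E × K)) := by rw [← hmult]; exact hx'
    have hnat : RingHom.prodMap σ σK (incl z) = incl (RingHom.prodMap σO σKO z) := Prod.ext (hσO' z.1).symm (hσKO z.2).symm
    rw [hnat] at hmem
    obtain ⟨z', hz', hzz'⟩ := Subring.mem_map.1 hmem
    rwa [← prodMap_integer_subtype_injective hzz']
  -- F3-1a (S3): `G(N″, b, σO c′) = ⋆G(N″, b, c′) ⊆ G(N″, b, c′)`, hence hermitian
  have hsub : {z : 𝒪[E] × 𝒪[K] | ∃ b₀ c₀ : 𝒪[E], z.2 = jO b₀ + jO c₀ * (jO (π ^ N'') * θ) ∧ z.1 - (b₀ + c₀ * σO c') ∈ Ideal.span {π ^ b}} ⊆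
      {z : 𝒪[E] × 𝒪[K] | ∃ b₀ c₀ : 𝒪[E], z.2 = jO b₀ + jO c₀ * (jO (π ^ N'') * θ) ∧ z.1 - (b₀ + c₀ * c') ∈ Ideal.span {π ^ b}} := by
    rw [← image_prodMap_glued jO θ π hcoord σO σKO hσσO hσ₁j hσ₁θ hσϖ N'' b c', ← hS]
    rintro _ ⟨z, hz, rfl⟩
    exact hstarS z hz
  have hherm : σO c' - c' ∈ Ideal.span ({π ^ b} : Set 𝒪[E]) := by
    obtain ⟨-, -, h⟩ := (glued_subset_glued_iff jO θ π hcoord (σO c') c' hπ0 hπu).1 hsub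
    rw [Nat.sub_self, pow_zero, one_mul] at h
    rw [← neg_sub]
    exact (Ideal.span ({π ^ b} : Set 𝒪[E])).neg_mem h
  refine ⟨hherm, ?_⟩
  rcases Nat.eq_zero_or_pos b with hb0 | hb1
  · exact Or.inl hb0
  · right
    -- (B3b) read integrally, then ★ (ii)
    obtain ⟨ν, hν⟩ := exists_setOf_inr_mem_eq_image σ σK hσO hK2 J hJ τ hK φ hφ τB hτB hstar O hO ⟨u, hu, rfl⟩ w hw
    obtain ⟨νO, hνO⟩ := exists_integer_slice_eq_image S hν
    rw [hS] at hνO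
    have hθ' : θ * θ = jO (ιO aF) * θ + jO (ιO k₀F) := by rw [← sq]; exact hθ
    exact level_of_slice_principal jO θ hθ' hcoord hϖ (map_k₀_mem_maximalIdeal ιO hιu haF) hk₁ hb1 hlaw ⟨νO, hνO⟩

/-! ## §2 `hgood` ∕ `hbad` at the glue depths `b ≥ 1`: the count and the emptiness, through the parity gate at a deep unitary generator -/

include hσι hfixO hιinj htr hιϖ in
/-- **A HERMITIAN CHARACTER VALUE AT A MONOGENIC LEVEL HAS A REPRESENTATIVE `ιO y` AT THE SAME LEVEL**, read in `𝒪_F` (★ F3-1a (S4) additive Hilbert 90, ★ (ii) `level_map_iff`;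
the level predicates are class functions modulo `π^b` since `b ≥ N″+1`, resp. `b = 2M ≥ M+1`). [cite: SerreLocalFields1979, Ch. X §1] [cite: Neukirch1999, Ch. I §12] -/
theorem exists_map_rep_and_level_of_level (hσσO : ∀ x, σO (σO x) = x) {N'' b : ℕ} {c' : 𝒪[E]}
    (hherm : σO c' - c' ∈ Ideal.span ({(⟨ϖ, hϖ.mem⟩ : 𝒪[E]) ^ b} : Set 𝒪[E]))
    (hlvl : (b = 2 * N'' + 1 ∧ c' ∈ Ideal.span ({(⟨ϖ, hϖ.mem⟩ : 𝒪[E]) ^ (N'' + 1)} : Set 𝒪[E])) ∨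
      ∃ M : ℕ, 1 ≤ M ∧ M ≤ N'' ∧ b = 2 * M ∧ c' ∈ Ideal.span ({(⟨ϖ, hϖ.mem⟩ : 𝒪[E]) ^ M} : Set 𝒪[E]) ∧
        c' ∉ Ideal.span ({(⟨ϖ, hϖ.mem⟩ : 𝒪[E]) ^ (M + 1)} : Set 𝒪[E])) :
    ∃ y : 𝒪[F], ιO y - c' ∈ Ideal.span ({(⟨ϖ, hϖ.mem⟩ : 𝒪[E]) ^ b} : Set 𝒪[E]) ∧
      ((b = 2 * N'' + 1 ∧ y ∈ Ideal.span ({(⟨ϖF, hϖF.mem⟩ : 𝒪[F]) ^ (N'' + 1)} : Set 𝒪[F])) ∨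
        ∃ M : ℕ, 1 ≤ M ∧ M ≤ N'' ∧ b = 2 * M ∧ y ∈ Ideal.span ({(⟨ϖF, hϖF.mem⟩ : 𝒪[F]) ^ M} : Set 𝒪[F]) ∧
          y ∉ Ideal.span ({(⟨ϖF, hϖF.mem⟩ : 𝒪[F]) ^ (M + 1)} : Set 𝒪[F])) := by
  set π : 𝒪[E] := ⟨ϖ, hϖ.mem⟩ with hπdef
  obtain ⟨y, hy⟩ := exists_map_rep_of_sub_mem_span π σO hσσO ιO hfixO htr hherm
  refine ⟨y, hy, (level_map_iff ιO σO hσι hfixO hιinj hϖF hϖ hιϖ y N'' b).1 ?_⟩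
  -- transfer the level from `c′` to `ιO y ≡ c′ (π^b)`
  have hmemiff : ∀ m : ℕ, m ≤ b → (ιO y ∈ Ideal.span ({π ^ m} : Set 𝒪[E]) ↔ c' ∈ Ideal.span ({π ^ m} : Set 𝒪[E])) := by
    intro m hm
    have h' : ιO y - c' ∈ Ideal.span ({π ^ m} : Set 𝒪[E]) := Ideal.span_singleton_le_span_singleton.2 (pow_dvd_pow π hm) hy
    constructor
    · intro h1; simpa using Ideal.sub_mem _ h1 h'
    · intro h2; simpa using Ideal.add_mem _ h2 h'
  rcases hlvl with ⟨hb, hc⟩ | ⟨M, hM1, hMN, hb, hcM, hcM1⟩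
  · exact Or.inl ⟨hb, (hmemiff (N'' + 1) (by omega)).2 hc⟩
  · exact Or.inr ⟨M, hM1, hMN, hb, (hmemiff M (by omega)).2 hcM, fun h => hcM1 ((hmemiff (M + 1) (by omega)).1 h)⟩

include hσσ hσO hJ hJh hK hφ hτB hstar hjO hσO' hσKO hσv hσKv hσι hfixO hιinj hιu htr hσ₁j hσ₁θ hθ haF hk₀ hcoord hnormE hnorm₁ hιϖ hk₁ hq hξ hnormEb hgate in
/-- **`hgood` (`b ≥ 1`) — THE RIGHT-PARITY STRATUM OF A HERMITIAN MONOGENIC-LEVEL CLASS HAS `(q+1)·q^{N″+b−1}` ELEMENTS.**  For `σO c′ ≡ c′ (π^b)` at a monogenic level with `b ≡ cls`: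
`c′ ≡ ιO y` (§2), ★ (UG) gives a deep unitary `x′` with `𝒪_E[x′] = G(N″, b, ιO y) = G(N″, b, c′)` (★ `glued_eq_glued_iff`) =: `↑S`; `hgate` yields a self-dual `incl S`-cyclic lattice, hence
a good unit (★ F3-2a `exists_units_of_mem_over`); so `#S_{incl S} = [C : (incl S)^×]` (★ F3-2a) `= [C : S^×]` (★ (c4) §3) `= (#𝓀_F + 1)·#𝓀_F^{N″+b−1}` (★ (L3′) at `x′`).
[cite: Rogawski1990, §4.9 Lemma 4.9.3 p. 56, Prop. 4.9.1 (b) p. 55] [cite: Jacobowitz1962, §7] [cite: SerreLocalFields1979, Ch. V §2 Prop. 3; Ch. X §1] -/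
theorem exists_subring_ncard_stratum_eq_of_gate [Finite 𝓀[F]] [Finite 𝓀[E]] [IsDiscreteValuationRing 𝒪[E]] {N'' b : ℕ} {c' : 𝒪[E]} (hb : 1 ≤ b)
    (hherm : σO c' - c' ∈ Ideal.span ({(⟨ϖ, hϖ.mem⟩ : 𝒪[E]) ^ b} : Set 𝒪[E]))
    (hlvl : (b = 2 * N'' + 1 ∧ c' ∈ Ideal.span ({(⟨ϖ, hϖ.mem⟩ : 𝒪[E]) ^ (N'' + 1)} : Set 𝒪[E])) ∨
      ∃ M : ℕ, 1 ≤ M ∧ M ≤ N'' ∧ b = 2 * M ∧ c' ∈ Ideal.span ({(⟨ϖ, hϖ.mem⟩ : 𝒪[E]) ^ M} : Set 𝒪[E]) ∧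
        c' ∉ Ideal.span ({(⟨ϖ, hϖ.mem⟩ : 𝒪[E]) ^ (M + 1)} : Set 𝒪[E]))
    (hcls : b % 2 = cls) :
    ∃ S : Subring (𝒪[E] × 𝒪[K]), (S : Set (𝒪[E] × 𝒪[K])) =
        {z : 𝒪[E] × 𝒪[K] | ∃ b₀ c₀ : 𝒪[E], z.2 = jO b₀ + jO c₀ * (jO ((⟨ϖ, hϖ.mem⟩ : 𝒪[E]) ^ N'') * θ) ∧
          z.1 - (b₀ + c₀ * c') ∈ Ideal.span {(⟨ϖ, hϖ.mem⟩ : 𝒪[E]) ^ b}} ∧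
      {Λ : Submodule 𝒪[E] (Fin 3 → E) |
          (∃ u ∈ unitaryGroupOfForm σ (J : Matrix (Fin 3) (Fin 3) E), Λ = Submodule.span 𝒪[E] (Set.range ((u : Matrix (Fin 3) (Fin 3) E))ᵀ)) ∧
            ∃ w : Fin 3 → E, Λ = Submodule.span 𝒪[E] ((fun x : E × K => φ x *ᵥ w) ''
              ((S.map (RingHom.prodMap (𝒪[E]).subtype (𝒪[K]).subtype) : Subring (E × K)) : Set (E × K)))}.ncard =
        (Nat.card 𝓀[F] + 1) * Nat.card 𝓀[F] ^ (N'' + b - 1) := by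
  set π : 𝒪[E] := ⟨ϖ, hϖ.mem⟩ with hπdef
  have hπ0 : π ≠ 0 := hϖ.coe_ne_zero
  have hσσO : ∀ x, σO (σO x) = x := fun x => Subtype.ext (by rw [hσO', hσO', hσσ])
  set incl : 𝒪[E] × 𝒪[K] →+* E × K := RingHom.prodMap (𝒪[E]).subtype (𝒪[K]).subtype with hincl
  -- F3-2a's frame hypotheses in `E`-currency
  have htrE : ∃ b₀ : 𝒪[E], (b₀ : E) + σ b₀ = 1 := by
    obtain ⟨b₀, hb₀⟩ := htr
    exact ⟨b₀, by rw [← hσO', ← Subring.coe_add, hb₀]; rfl⟩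
  have hnorm : ∀ v : 𝒪[E], IsUnit v → σ v = v → ∃ t : 𝒪[E], (t : E) * σ t = v := by
    intro v hv hσv'
    obtain ⟨c, hc⟩ := hnormE v hv (Subtype.ext (by rw [hσO']; exact hσv'))
    exact ⟨c, by rw [← hσO', ← Subring.coe_mul, hc]⟩
  -- §2: the representative `ιO y` at the same level; ★ (UG)'s deep unitary generator of `G(N″, b, ιO y) = G(N″, b, c′)`
  obtain ⟨y, hy, hlvlF⟩ := exists_map_rep_and_level_of_level σO ιO hσι hfixO hιinj htr hϖF hϖ hιϖ hσσO hherm hlvl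
  obtain ⟨u', p', q', t', D', hxstar, hu1, hp1, hχ1, hlam2, hN, hn, hset⟩ :=
    exists_unitary_generator_glued ιO σO jO σKO θ hσσO hσι hιu hσ₁j hσ₁θ hθ haF hk₀ hcoord hϖF hϖ hιϖ hk₁ hξ (hnormEb b hb) hlvlF
  set S : Subring (𝒪[E] × 𝒪[K]) := (Polynomial.eval₂RingHom (RingHom.prod (RingHom.id 𝒪[E]) jO) ((u', jO p' + jO q' * θ) : 𝒪[E] × 𝒪[K])).range with hSdef
  have hS : (S : Set (𝒪[E] × 𝒪[K])) =
      {z : 𝒪[E] × 𝒪[K] | ∃ b₀ c₀ : 𝒪[E], z.2 = jO b₀ + jO c₀ * (jO (π ^ N'') * θ) ∧ z.1 - (b₀ + c₀ * c') ∈ Ideal.span {π ^ b}} := by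
    rw [hSdef, hset]; exact (glued_eq_glued_iff jO θ π hcoord N'' b (ιO y) c' hπ0).2 hy
  set O : Subring (E × K) := S.map incl with hOdef
  have hO : ∀ r : 𝒪[E], algebraMap E (E × K) (r : E) ∈ O := algebraMap_mem_map_of_coe_eq_glued jO hjO θ hϖ S hS
  refine ⟨S, hS, ?_⟩
  -- the gate: a self-dual `O`-cyclic lattice, hence a good unit
  obtain ⟨w, g, hg, hwg⟩ := (hgate N'' b u' p' q' t' D' hb hxstar hu1 hp1 hχ1 hlam2 hN hn).2 hcls
  obtain ⟨b₀, hb₀, -⟩ := exists_units_of_mem_over σ J τ hK φ hφ τB hτB O hO ⟨⟨g, hg, hwg⟩, w, rfl⟩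
  -- ★ F3-2a count, ★ (c4) §3 transport, ★ (L3′) value
  rw [ncard_setOf_selfDual_cyclicOver_eq_relIndex σ hσσ hσO htrE hnorm J hJ hJh τ hK φ hφ τB hτB (RingHom.prodMap σ σK) hstar O hO b₀ hb₀, hOdef, hincl,
    relIndex_units_map_prodMap_eq σO σ hσO' σKO σK hσKO hσv hσKv S, hSdef]
  exact relIndex_units_comap_norm_eq_eisenstein ιO σO jO σKO θ u' hσσO hσι hfixO hιinj hιu hσ₁j hσ₁θ hθ haF hk₀ hcoord rfl hlam2 hu1 hp1 hχ1
    hxstar hnormE hnorm₁ hϖF hϖ hιϖ hn hN hq hξ (by omega)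

include hσσ hK hφ hτB hjO hσO' hσι hfixO hιinj hιu htr hσ₁j hσ₁θ hθ haF hk₀ hcoord hιϖ hk₁ hξ hnormEb hgate in
/-- **`hbad` (`b ≥ 1`) — THE WRONG-PARITY STRATUM OF A HERMITIAN MONOGENIC-LEVEL CLASS IS EMPTY.**  With `x′` as in `exists_subring_ncard_stratum_eq_of_gate`, `𝒪_E[x′] = ↑S` for EVERY
subring `S` with `↑S = G(N″, b, c′)`; under `b ≢ cls` the gate forbids self-dual `incl S`-cyclic lattices, so the stratum is `∅` (★ F3-2a `setOf_selfDual_cyclicOver_eq_empty`).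
[cite: Rogawski1990, §4.9 Lemma 4.9.3 p. 56] [cite: Jacobowitz1962, §7] -/
theorem stratum_eq_empty_of_gate [IsDiscreteValuationRing 𝒪[E]] {N'' b : ℕ} {c' : 𝒪[E]} (hb : 1 ≤ b)
    (hherm : σO c' - c' ∈ Ideal.span ({(⟨ϖ, hϖ.mem⟩ : 𝒪[E]) ^ b} : Set 𝒪[E]))
    (hlvl : (b = 2 * N'' + 1 ∧ c' ∈ Ideal.span ({(⟨ϖ, hϖ.mem⟩ : 𝒪[E]) ^ (N'' + 1)} : Set 𝒪[E])) ∨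
      ∃ M : ℕ, 1 ≤ M ∧ M ≤ N'' ∧ b = 2 * M ∧ c' ∈ Ideal.span ({(⟨ϖ, hϖ.mem⟩ : 𝒪[E]) ^ M} : Set 𝒪[E]) ∧
        c' ∉ Ideal.span ({(⟨ϖ, hϖ.mem⟩ : 𝒪[E]) ^ (M + 1)} : Set 𝒪[E]))
    (hcls : b % 2 ≠ cls) (S : Subring (𝒪[E] × 𝒪[K]))
    (hS : (S : Set (𝒪[E] × 𝒪[K])) = {z : 𝒪[E] × 𝒪[K] | ∃ b₀ c₀ : 𝒪[E], z.2 = jO b₀ + jO c₀ * (jO ((⟨ϖ, hϖ.mem⟩ : 𝒪[E]) ^ N'') * θ) ∧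
      z.1 - (b₀ + c₀ * c') ∈ Ideal.span {(⟨ϖ, hϖ.mem⟩ : 𝒪[E]) ^ b}}) :
    {Λ : Submodule 𝒪[E] (Fin 3 → E) |
        (∃ u ∈ unitaryGroupOfForm σ (J : Matrix (Fin 3) (Fin 3) E), Λ = Submodule.span 𝒪[E] (Set.range ((u : Matrix (Fin 3) (Fin 3) E))ᵀ)) ∧
          ∃ w : Fin 3 → E, Λ = Submodule.span 𝒪[E] ((fun x : E × K => φ x *ᵥ w) ''
            ((S.map (RingHom.prodMap (𝒪[E]).subtype (𝒪[K]).subtype) : Subring (E × K)) : Set (E × K)))} = ∅ := by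
  set π : 𝒪[E] := ⟨ϖ, hϖ.mem⟩ with hπdef
  have hπ0 : π ≠ 0 := hϖ.coe_ne_zero
  have hσσO : ∀ x, σO (σO x) = x := fun x => Subtype.ext (by rw [hσO', hσO', hσσ])
  set incl : 𝒪[E] × 𝒪[K] →+* E × K := RingHom.prodMap (𝒪[E]).subtype (𝒪[K]).subtype with hincl
  obtain ⟨y, hy, hlvlF⟩ := exists_map_rep_and_level_of_level σO ιO hσι hfixO hιinj htr hϖF hϖ hιϖ hσσO hherm hlvl
  obtain ⟨u', p', q', t', D', hxstar, hu1, hp1, hχ1, hlam2, hN, hn, hset⟩ :=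
    exists_unitary_generator_glued ιO σO jO σKO θ hσσO hσι hιu hσ₁j hσ₁θ hθ haF hk₀ hcoord hϖF hϖ hιϖ hk₁ hξ (hnormEb b hb) hlvlF
  -- `𝒪_E[x′] = S`
  have hRS : (Polynomial.eval₂RingHom (RingHom.prod (RingHom.id 𝒪[E]) jO) ((u', jO p' + jO q' * θ) : 𝒪[E] × 𝒪[K])).range = S := by
    refine SetLike.coe_injective ?_
    rw [hset, hS]; exact (glued_eq_glued_iff jO θ π hcoord N'' b (ιO y) c' hπ0).2 hy
  set O : Subring (E × K) := S.map incl with hOdef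
  have hO : ∀ r : 𝒪[E], algebraMap E (E × K) (r : E) ∈ O := algebraMap_mem_map_of_coe_eq_glued jO hjO θ hϖ S hS
  have hno : ∀ b₀ : (E × K)ˣ, ¬ ∃ u ∈ unitaryGroupOfForm σ (J : Matrix (Fin 3) (Fin 3) E),
      Submodule.span 𝒪[E] ((fun b' : E × K => φ b' *ᵥ (φ (b₀ : E × K) *ᵥ w₀)) '' (O : Set (E × K))) =
        Submodule.span 𝒪[E] (Set.range ((u : Matrix (Fin 3) (Fin 3) E))ᵀ) := by
    rintro b₀ ⟨u, hu, h⟩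
    refine hcls ((hgate N'' b u' p' q' t' D' hb hxstar hu1 hp1 hχ1 hlam2 hN hn).1 ⟨φ (b₀ : E × K) *ᵥ w₀, u, hu, ?_⟩)
    rw [hRS]; exact h
  exact setOf_selfDual_cyclicOver_eq_empty σ J τ hK φ hφ τB hτB O hO hno

end Literature.NumberTheory.Automorphic

end
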